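import Summits.CriticalPhenomena.PercolationContinuityZ3.Theorems.Transplant.Slab111HubTypes3
import Summits.CriticalPhenomena.PercolationContinuityZ3.Theorems.Transplant.Slab111VResid
import Summits.CriticalPhenomena.PercolationContinuityZ3.Theorems.Transplant.Slab111HubW18
import HarnessLib

/-!
# The HUB ROUTING of the `(111)`-films, XIX: what `Terminals` and `W18` give the unclipped-shape dispatcher (terminal rules, low-vertex membership)

builds on p205010 (kernel theorem, internal audit signed; external expert review pending) — NOT used in this file.  Lane `prim-bschramm`, seat
`prim-bschramm-p2` (gen 36; class C1b; memo `HOME/bschramm/P2-LATTICES.md` §130); helper file (`--supports stmt-CriticalPhenomena-4575 --as helper`).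
For the blocks with `t_R, s_R ≥ 2` and the cleared set «Slab111HubW18».`W18 k z`: §1 film neighbours in relative columns and what `∉ W18`
means; §2 the TERMINAL RULES of «Slab111HubTab3» from the data of «HexShadowVRouteData».`Terminals` — `ruleXB` (an `E`-terminal has a
neighbour outside `W18`: it is on ring `2`, or on ring `1` at level `1` / `k−1` over a `−U` / `U` column), `ruleR2B` (an `E`-terminal on its boundary
level has the exit `o` over a column outside the hexagon and a second neighbour `a` off `w'`'s column, not the other terminal), the corner rule;
§3 MEMBERSHIP of the low leg vertices accepted by `accB` (`low_mem`), the hypothesis `hm` of «Slab111HubEntry2».`Entry.swap2`.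
[cite: DuminilCopinSidoraviciusTassion2016, §2.3 (proof of Fact 2: the three disjoint paths γ_u, γ_v, γ_w in B_R(z))]
-/

noncomputable section

namespace Summit.CriticalPhenomena.PercolationContinuityZ3.Theorems.Transplant

open Literature.Probability.Percolation Literature.Probability.LatticeModels SimpleGraph
open scoped Classical

namespace Slab111

variable {k : ℕ}

/-! ## §1 Neighbours and non-members of `W18` -/

/-- The three up-steps as a list. [folklore] -/
def UPS : List (ℤ × ℤ) := [(1, 0), (0, -1), (-1, 1)]


/-- `rcol = relC`. [folklore] -/
theorem rcol_eq_relC (z : Site 2) (x : slab111 k) : rcol z x = relC z x := by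
  unfold rcol relC; rfl

/-- **Film neighbours in relative columns**: a neighbour is one up-step up or one up-step down. [folklore] -/
theorem nbr_relC {z : Site 2} {x y : slab111 k} (h : (film k).Adj x y) :
    ∃ u ∈ UPS, (relC z y = ((relC z x).1 + u.1, (relC z x).2 + u.2) ∧ lev (y : Site 3) = lev (x : Site 3) + 1) ∨
      (relC z y = ((relC z x).1 - u.1, (relC z x).2 - u.2) ∧ lev (y : Site 3) = lev (x : Site 3) - 1) := by
  obtain ⟨u, hu, h'⟩ := adj_model (z := z) h
  rw [rcol_eq_relC, rcol_eq_relC] at h'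
  exact ⟨u, by simpa [Srch.ups, UPS] using hu, h'⟩

/-- **A non-member of `W18`** over the hexagon's neighbourhood: its column is outside the hexagon, or it is a boundary-level corner. [folklore] -/
theorem not_mem_W18 {z : Site 2} {y : slab111 k} (h : y ∉ W18 k z) :
    2 < tnZ (relC z y) ∨ ((lev (y : Site 3) = 0 ∨ lev (y : Site 3) = k) ∧ cornerB (relC z y) = true) := by
  by_cases ht : tnZ (relC z y) ≤ 2
  · right; by_contra hbc; exact h ⟨ht, hbc⟩
  · left; omega

/-- Distinct film vertices at the same level have different columns. [folklore] -/
theorem relC_ne_of_ne {z : Site 2} {x y : slab111 k} (hne : x ≠ y) (hl : lev (x : Site 3) = lev (y : Site 3)) : relC z x ≠ relC z y := by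
  intro e; apply hne
  exact eq_of_sh_eq_of_lev_eq (by rw [sh_eq_vcol_relC z x, sh_eq_vcol_relC z y, e]) hl

/-- Different shadows means different relative columns. [folklore] -/
theorem relC_ne_of_sh_ne {z : Site 2} {x y : slab111 k} (h : sh x ≠ sh y) : relC z x ≠ relC z y := by
  intro e; apply h; rw [sh_eq_vcol_relC z x, sh_eq_vcol_relC z y, e]

/-! ## §2 The terminal rules -/

/-- **Terminal rule X** (from `Terminals.nbrs`: an `E`-terminal has a neighbour outside `W18`): an `E`-terminal sits on ring `2`, or on ring `1`
next to a removed boundary corner — flag `1` and column in `−U` (below) / `U` (above). [folklore] -/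
def ruleXB (q : ℤ × ℤ) (d : ℤ) (β : ℕ) : Bool :=
  decide (tnZ q = 2) || (decide (tnZ q = 1) && (β == 1) && (if d = 1 then UPS.any fun u => q == (-u.1, -u.2) else UPS.any fun u => q == u))

/-- **Terminal rule R2** (from `Terminals.nbrs` for an `E`-terminal ON its boundary level, flag `0`): among its three neighbour columns one is
outside the hexagon (the vertex `o ∉ W`) and another, different one (the vertex `a`) is neither `w'`'s column nor the other `E`-terminal. [folklore] -/
def ruleR2B (qi qj q₃ : ℤ × ℤ) (di dj : ℤ) (βi βj : ℕ) : Bool :=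
  !(βi == 0) ||
    (UPS.map fun u => (qi.1 + di * u.1, qi.2 + di * u.2)).any fun co => decide (2 < tnZ co) &&
      (UPS.map fun u => (qi.1 + di * u.1, qi.2 + di * u.2)).any fun ca =>
        (ca != co) && (ca != q₃) && !((ca == qj) && (dj == di) && (βj == 1))

/-- **The terminal rules of a pattern** (both `E`-terminals). [folklore] -/
def rulesB (q₁ q₂ q₃ : ℤ × ℤ) (d₁ d₂ _d₃ : ℤ) (β₁ β₂ _β₃ : ℕ) : Bool :=
  ruleXB q₁ d₁ β₁ && ruleXB q₂ d₂ β₂ && ruleR2B q₁ q₂ q₃ d₁ d₂ β₁ β₂ && ruleR2B q₂ q₁ q₃ d₂ d₁ β₂ β₁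

/-- **The flag filter of the unclipped shape**: flag `0` only off the corners (the boundary corners are missing from `W18`) and the terminal
rules. [folklore] -/
def u19Filt (q₁ q₂ q₃ : ℤ × ℤ) (d₁ d₂ d₃ : ℤ) (β₁ β₂ β₃ : ℕ) : Bool :=
  !((β₁ == 0) && cornerB q₁) && !((β₂ == 0) && cornerB q₂) && !((β₃ == 0) && cornerB q₃) && rulesB q₁ q₂ q₃ d₁ d₂ d₃ β₁ β₂ β₃

/-- The boundary-missing columns of `W18`: the corners, on both sides. [folklore] -/
def u19Bad (_d : ℤ) : ℤ × ℤ → Bool := cornerB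


/-- The finite geometry behind rule X (checked by `decide`). [folklore] -/
theorem ringFacts : ∀ q ∈ hex2, ∀ u ∈ UPS,
    ((2 < tnZ (q.1 + u.1, q.2 + u.2) ∨ 2 < tnZ (q.1 - u.1, q.2 - u.2)) → tnZ q = 2) ∧
    (cornerB (q.1 + u.1, q.2 + u.2) = true → tnZ q = 2 ∨ (tnZ q = 1 ∧ (UPS.any fun v => q == v) = true)) ∧
    (cornerB (q.1 - u.1, q.2 - u.2) = true → tnZ q = 2 ∨ (tnZ q = 1 ∧ (UPS.any fun v => q == (-v.1, -v.2)) = true)) := by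
  decide

/-- **RULE X from `Terminals`**: an `E`-terminal `E ∈ W18` (column `≠ z`, clearing the zone `Hlo` with `2 ≤ Hlo`, `Hlo + 3 ≤ k − 2`) with a
neighbour `o ∉ W18` satisfies `ruleXB` at its realised side and flag. [folklore] -/
theorem ruleX_of_terminal {z : Site 2} {Hlo : ℤ} (hH2 : 2 ≤ Hlo) (hHk : Hlo + 3 ≤ (k : ℤ) - 2) {E o : slab111 k} (hE : E ∈ W18 k z)
    (hc : Clears 3 Hlo (lev (E : Site 3))) (ho : o ∉ W18 k z) (hadj : (film k).Adj E o) :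
    ruleXB (relC z E) (dirOfLevel 3 Hlo (lev (E : Site 3))) (βOf k (dirOfLevel 3 Hlo (lev (E : Site 3))) (lev (E : Site 3))) = true := by
  have hq : relC z E ∈ hex2 := relC_mem_hex2' hE
  have hlevE := (mem_slab111_iff_lev.1 E.2)
  have hlevo := (mem_slab111_iff_lev.1 o.2)
  obtain ⟨u, hu, hn⟩ := nbr_relC (z := z) hadj
  obtain ⟨f1, f2, f3⟩ := ringFacts _ hq u hu
  have hout := not_mem_W18 ho
  unfold ruleXB
  rw [Bool.or_eq_true, decide_eq_true_eq]
  unfold Clears at hc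
  rcases hn with ⟨hcol, hl⟩ | ⟨hcol, hl⟩
  · -- `o` one level up
    rw [hcol] at hout
    rcases hout with ht | ⟨hb, hcr⟩
    · exact Or.inl (f1 (Or.inl ht))
    · rcases f2 hcr with h2 | ⟨h1, hU⟩
      · exact Or.inl h2
      · right
        have hk : lev (E : Site 3) = (k : ℤ) - 1 := by omega
        have hd : dirOfLevel 3 Hlo (lev (E : Site 3)) = -1 := by unfold dirOfLevel; rw [if_neg (by omega)]
        rw [hd]
        have hβ : βOf k (-1) (lev (E : Site 3)) = 1 := by
          unfold βOf; rw [if_neg (by norm_num), hk]; norm_num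
        rw [hβ, Bool.and_eq_true, Bool.and_eq_true, decide_eq_true_eq, if_neg (by norm_num)]
        exact ⟨⟨h1, rfl⟩, hU⟩
  · -- `o` one level down
    rw [hcol] at hout
    rcases hout with ht | ⟨hb, hcr⟩
    · exact Or.inl (f1 (Or.inr ht))
    · rcases f3 hcr with h2 | ⟨h1, hU⟩
      · exact Or.inl h2
      · right
        have h1' : lev (E : Site 3) = 1 := by omega
        have hd : dirOfLevel 3 Hlo (lev (E : Site 3)) = 1 := by unfold dirOfLevel; rw [if_pos (by omega)]
        rw [hd]
        have hβ : βOf k 1 (lev (E : Site 3)) = 1 := by unfold βOf; rw [if_pos rfl, h1']; norm_num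
        rw [hβ, Bool.and_eq_true, Bool.and_eq_true, decide_eq_true_eq, if_pos rfl]
        exact ⟨⟨h1, rfl⟩, hU⟩

/-- A negated triple conjunction of Booleans. [folklore] -/
theorem notAnd3 {a b c : Bool} (h : ¬ (a = true ∧ b = true ∧ c = true)) : (!((a && b) && c)) = true := by
  cases a <;> cases b <;> cases c <;> simp_all

/-- **RULE R2 from `Terminals`** for an `E`-terminal ON its boundary level (flag `0`): the exit `o ∉ W18` and the second neighbour `a` (`a ≠ o`,
`a ≠` the other terminal `E'`, `sh a ≠ sh w'`). [folklore] -/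
theorem ruleR2_of_terminal {z : Site 2} {Hlo : ℤ} (hk : 3 ≤ (k : ℤ)) {E E' w' o a : slab111 k}
    (hβ : βOf k (dirOfLevel 3 Hlo (lev (E : Site 3))) (lev (E : Site 3)) = 0) (ho : o ∉ W18 k z) (hoE : (film k).Adj o E)
    (hEa : (film k).Adj E a) (hao : a ≠ o) (haE' : a ≠ E') (haw : sh a ≠ sh w') {d' : ℤ} (hd' : d' = 1 ∨ d' = -1)
    (hn' : 0 ≤ lev (E' : Site 3) ∧ lev (E' : Site 3) ≤ k) :
    ruleR2B (relC z E) (relC z E') (relC z w') (dirOfLevel 3 Hlo (lev (E : Site 3))) d'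
      (βOf k (dirOfLevel 3 Hlo (lev (E : Site 3))) (lev (E : Site 3))) (βOf k d' (lev (E' : Site 3))) = true := by
  have hlevE := (mem_slab111_iff_lev.1 E.2)
  have hlevo := (mem_slab111_iff_lev.1 o.2)
  have hleva := (mem_slab111_iff_lev.1 a.2)
  have hdE := dirOfLevel_eq 3 Hlo (lev (E : Site 3))
  set d := dirOfLevel 3 Hlo (lev (E : Site 3)) with hdd
  have hsE := βOf_spec (k := k) hdE hlevE.1 hlevE.2
  have hdist := (hsE.2.1.1 hβ)
  obtain ⟨uo, huo, hno⟩ := nbr_relC (z := z) hoE.symm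
  obtain ⟨ua, hua, hna⟩ := nbr_relC (z := z) hEa
  have hs' := βOf_spec (k := k) hd' hn'.1 hn'.2
  -- the levels of `o` and `a`: one step INTO the film from the boundary level of `E`
  have key : ∀ {y : slab111 k} {u : ℤ × ℤ}, 0 ≤ lev (y : Site 3) → lev (y : Site 3) ≤ k →
      ((relC z y = ((relC z E).1 + u.1, (relC z E).2 + u.2) ∧ lev (y : Site 3) = lev (E : Site 3) + 1) ∨
        (relC z y = ((relC z E).1 - u.1, (relC z E).2 - u.2) ∧ lev (y : Site 3) = lev (E : Site 3) - 1)) →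
      relC z y = ((relC z E).1 + d * u.1, (relC z E).2 + d * u.2) ∧ lev (y : Site 3) = lev (E : Site 3) + d := by
    intro y u hy0 hyk hy
    rcases hdE with e | e <;> rw [e] at hdist ⊢
    · simp only [↓reduceIte] at hdist
      rcases hy with ⟨hc, hl⟩ | ⟨hc, hl⟩
      · exact ⟨by rw [hc]; simp, by omega⟩
      · omega
    · simp only [show ¬ ((-1 : ℤ) = 1) by norm_num, ↓reduceIte] at hdist
      rcases hy with ⟨hc, hl⟩ | ⟨hc, hl⟩
      · omega
      · exact ⟨by rw [hc]; ext <;> simp <;> ring, by omega⟩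
  obtain ⟨hco, hlo⟩ := key hlevo.1 hlevo.2 hno
  obtain ⟨hca, hla⟩ := key hleva.1 hleva.2 hna
  -- `o`: outside the hexagon (its level is a bulk level)
  have hot : 2 < tnZ (relC z o) := by
    rcases not_mem_W18 ho with h | ⟨hb, -⟩
    · exact h
    · exfalso
      rcases hdE with e | e <;> rw [e] at hdist hlo
      · simp only [↓reduceIte] at hdist; omega
      · simp only [show ¬ ((-1 : ℤ) = 1) by norm_num, ↓reduceIte] at hdist; omega
  unfold ruleR2B
  rw [hβ]
  simp only [beq_self_eq_true, Bool.not_true, Bool.false_or]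
  rw [List.any_eq_true]
  refine ⟨relC z o, List.mem_map.2 ⟨uo, huo, hco.symm⟩, ?_⟩
  rw [Bool.and_eq_true, decide_eq_true_eq, List.any_eq_true]
  refine ⟨hot, relC z a, List.mem_map.2 ⟨ua, hua, hca.symm⟩, ?_⟩
  rw [Bool.and_eq_true, Bool.and_eq_true, bne_iff_ne, bne_iff_ne]
  refine ⟨⟨relC_ne_of_ne hao (by rw [hla, hlo]), relC_ne_of_sh_ne haw⟩, notAnd3 fun ⟨hcq, hdd', hb1⟩ => ?_⟩
  rw [beq_iff_eq] at hcq hdd' hb1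
  -- `a` is not the other terminal: same column, same side and flag 1 would put `E'` at `a`'s level
  apply haE'
  apply eq_of_sh_eq_of_lev_eq (by rw [sh_eq_vcol_relC z a, sh_eq_vcol_relC z E', hcq])
  have := hs'.2.2.1.1 hb1
  rw [hdd'] at this
  rcases hdE with e | e <;> rw [e] at hdist this hla
  · simp only [↓reduceIte] at hdist this; omega
  · simp only [show ¬ ((-1 : ℤ) = 1) by norm_num, ↓reduceIte] at hdist this; omega

/-- **The corner rule**: a member of `W18` on a boundary level is not over a corner; in flag form. [folklore] -/
theorem corner_of_flag {z : Site 2} {Hlo : ℤ} {x : slab111 k} (hx : x ∈ W18 k z)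
    (hβ : βOf k (dirOfLevel 3 Hlo (lev (x : Site 3))) (lev (x : Site 3)) = 0) : cornerB (relC z x) = false := by
  have hlev := (mem_slab111_iff_lev.1 x.2)
  have hd := dirOfLevel_eq 3 Hlo (lev (x : Site 3))
  have hs := βOf_spec (k := k) hd hlev.1 hlev.2
  have hdist := hs.2.1.1 hβ
  have hb : lev (x : Site 3) = 0 ∨ lev (x : Site 3) = k := by
    rcases hd with e | e <;> rw [e] at hdist
    · simp only [↓reduceIte] at hdist; exact Or.inl hdist
    · simp only [show ¬ ((-1 : ℤ) = 1) by norm_num, ↓reduceIte] at hdist; exact Or.inr (by omega)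
  rw [Bool.eq_false_iff]
  exact fun hc => hx.2 ⟨hb, hc⟩

/-! ## §3 Membership of the low leg vertices -/

/-- **LOW-VERTEX MEMBERSHIP** (`hm` of `Entry.swap2`): for a leg fitting over the hexagon's columns and accepted by `accB` at the terminal's
realised flag, every non-terminal vertex at `d·Δℓ ≤ 0` is a film vertex of `W18` (bulk level, or boundary level over a non-corner). [folklore] -/
theorem low_mem {z : Site 2} {c0 Hlo : ℤ} (hz : (3 : ℤ) ∣ z 0 + 2 * z 1 - c0) (hH2 : 2 ≤ Hlo) (hHk : Hlo + 3 ≤ (k : ℤ) - 2) {l : List MV} {q : ℤ × ℤ}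
    {F : FaceD} {n : ℤ} (hn : 0 ≤ n ∧ n ≤ k) (hq : (3 : ℤ) ∣ n - c0 - (q.1 + 2 * q.2)) (hc : Clears 3 Hlo n)
    (hL : LegFits2 l q F hex2 (dirOfLevel 3 Hlo n) 3) (hacc : accB l q (dirOfLevel 3 Hlo n) (βOf k (dirOfLevel 3 Hlo n) n) cornerB = true) :
    ∀ p ∈ l, p ≠ ((0, 0), 0) → dirOfLevel 3 Hlo n * p.2 ≤ 0 →
      (0 ≤ n + p.2 ∧ n + p.2 ≤ k) ∧ vl k (vcol z (q + p.1)) (n + p.2) ∈ W18 k z := by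
  intro p hp hp0 hlow
  obtain ⟨hl, -, -, -, -, hreg⟩ := hL
  obtain ⟨hcq, hlo, -⟩ := hreg p hp hp0
  have hcls : (3 : ℤ) ∣ n + p.2 - c0 - ((q + p.1).1 + 2 * (q + p.1).2) := by
    have h2 := hl.2.2.2.2 p hp; unfold RAdm at h2
    have e : n + p.2 - c0 - ((q + p.1).1 + 2 * (q + p.1).2) = (n - c0 - (q.1 + 2 * q.2)) + (p.2 - (p.1.1 + 2 * p.1.2)) := by
      simp only [Prod.fst_add, Prod.snd_add]; ring
    rw [e]; exact dvd_add hq h2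
  have hd := dirOfLevel_eq 3 Hlo n
  have hm := dir_margin hc
  have hs := βOf_spec (k := k) hd hn.1 hn.2
  have d0 := hs.1; have b0 := hs.2.1; have b1 := hs.2.2.1; have b2 := hs.2.2.2
  have hacc' := accB_low hacc hp hp0 hlow
  -- the level `L = n + p.2` is in `[0, k]`, and if it is a boundary level the column is not a corner
  have main : (0 ≤ n + p.2 ∧ n + p.2 ≤ k) ∧ ((n + p.2 = 0 ∨ n + p.2 = k) → cornerB (q + p.1) = false) := by
    rcases hd with e | e <;> rw [e] at hlow hlo hacc' b0 b1 b2 d0 hm <;> simp only [↓reduceIte, show ¬ ((-1 : ℤ) = 1) by norm_num] at b0 b1 b2 d0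
    · have h5 := hm.1 rfl
      rcases hacc' with h2 | ⟨h0, hcz⟩
      · have := b2.1 h2; exact ⟨⟨by omega, by omega⟩, fun hb => by omega⟩
      · have hβ := βOf_lt k 1 n
        refine ⟨⟨?_, by omega⟩, fun hb => hcz ?_⟩
        · interval_cases hh : βOf k 1 n
          · have := b0.1 rfl; omega
          · have := b1.1 rfl; omega
          · have := b2.1 rfl; omega
        · interval_cases hh : βOf k 1 n
          · have := b0.1 rfl; push_cast; omega
          · have := b1.1 rfl; push_cast; omega
          · have := b2.1 rfl; omega
    · have h5 := hm.2 rfl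
      rcases hacc' with h2 | ⟨h0, hcz⟩
      · have := b2.1 h2; exact ⟨⟨by omega, by omega⟩, fun hb => by omega⟩
      · have hβ := βOf_lt k (-1) n
        refine ⟨⟨by omega, ?_⟩, fun hb => hcz ?_⟩
        · interval_cases hh : βOf k (-1) n
          · have := b0.1 rfl; omega
          · have := b1.1 rfl; omega
          · have := b2.1 rfl; omega
        · interval_cases hh : βOf k (-1) n
          · have := b0.1 rfl; push_cast; omega
          · have := b1.1 rfl; push_cast; omega
          · have := b2.1 rfl; omega
  obtain ⟨hrange, hcorner⟩ := main
  refine ⟨hrange, ?_⟩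
  by_cases hb : n + p.2 = 0 ∨ n + p.2 = k
  · exact vl_mem_W18_bdry hz hcq (hcorner hb) hrange.1 hrange.2 hcls
  · have h1 : n + p.2 ≠ 0 := fun e => hb (Or.inl e)
    have h2 : n + p.2 ≠ (k : ℤ) := fun e => hb (Or.inr e)
    exact vl_mem_W18 hz _ hcq _ (by omega) (by omega) hcls

end Slab111

end Summit.CriticalPhenomena.PercolationContinuityZ3.Theorems.Transplant

end
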